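import Literature.MathematicalPhysics.KineticTheory.ConfinedForcedFlow
import HarnessLib

/-!
# Additive-noise SDEs with a confined drift: time reversal of the pathwise flow

Trunk T-KINETIC (Literature/MathematicalPhysics/KineticTheory); theorems and one small definition,
no named facts. For the pathwise flow `z = drivenFlow Y x n` of

  `z(t) = x + n(t) + ∫₀ᵗ Y(z(s)) ds`                                                        (IE)

(`ConfinedForcedFlow.lean`) and a horizon `T ≥ 0`, the REVERSED trajectory `y(s) = z(T - s)`
solves (IE) for the REVERSED DRIFT `-Y`, started at `z(T)` and driven by the REVERSED NOISE PATH

  `ñ(s) = n(T - s) - n(T)`      (`reversePath n T`),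

because `∫₀ˢ (-Y)(z(T - u)) du = -∫_{T-s}^T Y(z(u)) du`. Consequently, when both `Y` and `-Y` are
confined drifts (as for Hamiltonian systems with linear friction: reversing time turns friction
into anti-friction, and the energy still grows at most linearly), the time-`T` map
`x ↦ Φ_T(x, n) = drivenFlow Y x n T` is a BIJECTION of the state space whose inverse is the
time-`T` map of the reversed drift driven by the reversed path:

* `reversePath`, `reversePath_reversePath` (`ñ̃ = n` when `n(0) = 0`);
* `ConfinedDrift.isIntegralSolutionOn_reverse` — the reversed trajectory solves the reversed (IE);
* `ConfinedDrift.flow_reverse_eqOn` — `Φ_s(Φ_T(x, n), ñ; -Y) = Φ_{T-s}(x, n; Y)` on `[0, T]`;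
* `ConfinedDrift.flow_reverse_apply` / `flow_apply_flow_reverse` — the two maps are mutually
  inverse; `ConfinedDrift.flow_bijective`.

This is the deterministic half of the time-reversal (duality) relation between the transition
semigroups of `dz = Y dt + dB` and `dz = -Y dt + dB` with respect to Lebesgue measure (the
other half being the invariance of the Wiener measure under `B ↦ B(T - ·) - B(T)`).

## References

* U. G. Haussmann, É. Pardoux, *Time reversal of diffusions*, Ann. Probab. 14 (1986) 1188–1205
  (time reversal of diffusion processes; here the additive-noise case, pathwise).
* E. A. Coddington, N. Levinson, *Theory of Ordinary Differential Equations* (1955), Ch. 1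
  (uniqueness for integral equations). [folklore]
-/

noncomputable section

open MeasureTheory Filter Topology Set Metric
open scoped NNReal

namespace Literature.MathematicalPhysics.KineticTheory

open Literature.Analysis.ODE

variable {E : Type*} [NormedAddCommGroup E] [NormedSpace ℝ E]

/-! ### The reversed noise path -/

/-- The **noise path reversed at time `T`**: `ñ(s) = n(T - s) - n(T)` (so `ñ(0) = 0`; it is the
forcing of the time-reversed trajectory). [folklore] -/
def reversePath (n : ℝ → E) (T : ℝ) (s : ℝ) : E :=
  n (T - s) - n T

omit [NormedSpace ℝ E] in
/-- Unfolding `reversePath`. [folklore] -/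
@[simp] theorem reversePath_apply (n : ℝ → E) (T s : ℝ) : reversePath n T s = n (T - s) - n T := rfl

omit [NormedSpace ℝ E] in
/-- `ñ(0) = 0`. [folklore] -/
@[simp] theorem reversePath_zero (n : ℝ → E) (T : ℝ) : reversePath n T 0 = 0 := by
  simp [reversePath]

omit [NormedSpace ℝ E] in
/-- `ñ(T) = n(0) - n(T)`. [folklore] -/
theorem reversePath_self (n : ℝ → E) (T : ℝ) : reversePath n T T = n 0 - n T := by
  simp [reversePath]

omit [NormedSpace ℝ E] in
/-- The reversed path of a continuous path is continuous. [folklore] -/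
theorem continuous_reversePath {n : ℝ → E} (hn : Continuous n) (T : ℝ) :
    Continuous (reversePath n T) := by
  unfold reversePath
  fun_prop

/-- The reversed path stays in any submodule containing the path. [folklore] -/
theorem reversePath_mem {S : Submodule ℝ E} {n : ℝ → E} (h : ∀ t, n t ∈ S) (T s : ℝ) :
    reversePath n T s ∈ S :=
  S.sub_mem (h _) (h _)

omit [NormedSpace ℝ E] in
/-- **Reversing twice gives back the path** (for paths starting at `0`). [folklore] -/
theorem reversePath_reversePath {n : ℝ → E} (hn0 : n 0 = 0) (T : ℝ) :
    reversePath (reversePath n T) T = n := by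
  funext s
  simp [reversePath, hn0]

/-! ### The reversed trajectory solves the reversed equation -/

namespace ConfinedDrift

variable [FiniteDimensional ℝ E] [CompleteSpace E] {Y Y' : E → E} (D : ConfinedDrift Y)
include D

/-- **The reversed trajectory solves the reversed integral equation**: for `z = drivenFlow Y x n`,
`T ≥ 0` and `Y' = -Y`, the path `s ↦ z(T - s)` satisfies
`z(T - s) = z(T) + ñ(s) + ∫₀ˢ Y'(z(T - u)) du` on `[0, T]`, `ñ = reversePath n T`. [folklore] -/
theorem isIntegralSolutionOn_reverse (hY' : ∀ y, Y' y = -Y y) (x : E) {n : ℝ → E}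
    (hn : Continuous n) (hnS : ∀ t, n t ∈ D.noise) {T : ℝ} (hT : 0 ≤ T) :
    IsIntegralSolutionOn Y' (fun s => drivenFlow Y x n T + reversePath n T s)
      (fun s => drivenFlow Y x n (T - s)) T := by
  set z := drivenFlow Y x n with hz_def
  have hz := D.isIntegralSolutionOn_flow x hn hnS T
  have hzc : Continuous z := D.continuous_flow x hn hnS
  have hYzc : Continuous fun u => Y (z u) := D.contDiff_drift.continuous.comp hzc
  have hint : ∀ a b, IntervalIntegrable (fun u => Y (z u)) volume a b := fun a b =>
    hYzc.intervalIntegrable a b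
  intro s hs
  have hTs : T - s ∈ Icc 0 T := ⟨sub_nonneg.2 hs.2, sub_le_self _ hs.1⟩
  show z (T - s) = z T + reversePath n T s + ∫ u in (0 : ℝ)..s, Y' (z (T - u))
  have hz1 : z (T - s) = x + n (T - s) + ∫ u in (0 : ℝ)..(T - s), Y (z u) := hz (T - s) hTs
  have hz2 : z T = x + n T + ∫ u in (0 : ℝ)..T, Y (z u) := hz T ⟨hT, le_rfl⟩
  rw [hz1, hz2]
  simp only [reversePath_apply]
  -- the reversed integral
  have hrev : ∫ u in (0 : ℝ)..s, Y' (z (T - u)) = -∫ u in (T - s)..T, Y (z u) := by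
    have h1 : (fun u => Y' (z (T - u))) = fun u => -Y (z (T - u)) := funext fun u => hY' _
    rw [h1, intervalIntegral.integral_neg]
    congr 1
    have := intervalIntegral.integral_comp_sub_left (fun u => Y (z u)) T (a := 0) (b := s)
    rw [this, sub_zero]
  rw [hrev]
  have hsplit : ∫ u in (0 : ℝ)..T, Y (z u) =
      (∫ u in (0 : ℝ)..(T - s), Y (z u)) + ∫ u in (T - s)..T, Y (z u) :=
    (intervalIntegral.integral_add_adjacent_intervals (hint _ _) (hint _ _)).symm
  rw [hsplit]
  abel

variable (D' : ConfinedDrift Y')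
include D'

/-- **The reversed flow runs the trajectory backwards**: for `Y' = -Y` (both confined) and a
continuous noise path in both noise subspaces,
`drivenFlow Y' (drivenFlow Y x n T) (reversePath n T) s = drivenFlow Y x n (T - s)` for
`s ∈ [0, T]`. [folklore] -/
theorem flow_reverse_eqOn (hY' : ∀ y, Y' y = -Y y) (x : E) {n : ℝ → E} (hn : Continuous n)
    (hnS : ∀ t, n t ∈ D.noise) (hnS' : ∀ t, n t ∈ D'.noise) {T : ℝ} (hT : 0 ≤ T) :
    EqOn (fun s => drivenFlow Y' (drivenFlow Y x n T) (reversePath n T) s)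
      (fun s => drivenFlow Y x n (T - s)) (Icc 0 T) := by
  have hsol := D.isIntegralSolutionOn_reverse hY' x hn hnS hT
  have hc : Continuous fun s => drivenFlow Y x n (T - s) :=
    (D.continuous_flow x hn hnS).comp (continuous_const.sub continuous_id)
  exact (D'.eqOn_flow (drivenFlow Y x n T) (continuous_reversePath hn T)
    (fun s => reversePath_mem hnS' T s) hsol hc).symm

/-- **The reversed flow inverts the flow**: `drivenFlow Y' (drivenFlow Y x n T) (reversePath n T) T = x`
for a noise path with `n(0) = 0`. [folklore] -/
theorem flow_reverse_apply (hY' : ∀ y, Y' y = -Y y) (x : E) {n : ℝ → E} (hn : Continuous n)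
    (hnS : ∀ t, n t ∈ D.noise) (hnS' : ∀ t, n t ∈ D'.noise) (hn0 : n 0 = 0) {T : ℝ} (hT : 0 ≤ T) :
    drivenFlow Y' (drivenFlow Y x n T) (reversePath n T) T = x := by
  have h := D.flow_reverse_eqOn D' hY' x hn hnS hnS' hT ⟨hT, le_rfl⟩
  simp only [sub_self] at h
  rw [h, D.flow_of_nonpos x hn le_rfl, hn0, add_zero]

/-- **The flow inverts the reversed flow**: `drivenFlow Y (drivenFlow Y' y (reversePath n T) T) n T = y`
for a noise path with `n(0) = 0`. [folklore] -/
theorem flow_apply_flow_reverse (hY' : ∀ y, Y' y = -Y y) (y : E) {n : ℝ → E} (hn : Continuous n)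
    (hnS : ∀ t, n t ∈ D.noise) (hnS' : ∀ t, n t ∈ D'.noise) (hn0 : n 0 = 0) {T : ℝ} (hT : 0 ≤ T) :
    drivenFlow Y (drivenFlow Y' y (reversePath n T) T) n T = y := by
  have hY : ∀ y, Y y = -Y' y := fun y => by rw [hY', neg_neg]
  have h := D'.flow_reverse_apply D hY y (continuous_reversePath hn T)
    (fun s => reversePath_mem hnS' T s) (fun s => reversePath_mem hnS T s) (reversePath_zero n T) hT
  rwa [reversePath_reversePath hn0] at h

/-- **The time-`T` map of the flow is a bijection** of the state space (inverse: the time-`T`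
map of the reversed drift driven by the reversed noise path). [folklore] -/
theorem flow_bijective (hY' : ∀ y, Y' y = -Y y) {n : ℝ → E} (hn : Continuous n)
    (hnS : ∀ t, n t ∈ D.noise) (hnS' : ∀ t, n t ∈ D'.noise) (hn0 : n 0 = 0) {T : ℝ} (hT : 0 ≤ T) :
    Function.Bijective fun x => drivenFlow Y x n T := by
  refine Function.bijective_iff_has_inverse.2
    ⟨fun y => drivenFlow Y' y (reversePath n T) T, fun x => ?_, fun y => ?_⟩
  · exact D.flow_reverse_apply D' hY' x hn hnS hnS' hn0 hT
  · exact D.flow_apply_flow_reverse D' hY' y hn hnS hnS' hn0 hT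

/-- The time-`T` map of the flow is injective. [folklore] -/
theorem flow_injective (hY' : ∀ y, Y' y = -Y y) {n : ℝ → E} (hn : Continuous n)
    (hnS : ∀ t, n t ∈ D.noise) (hnS' : ∀ t, n t ∈ D'.noise) (hn0 : n 0 = 0) {T : ℝ} (hT : 0 ≤ T) :
    Function.Injective fun x => drivenFlow Y x n T :=
  (D.flow_bijective D' hY' hn hnS hnS' hn0 hT).injective

/-- The time-`T` map of the flow is surjective: its range is the whole space. [folklore] -/
theorem range_flow_eq_univ (hY' : ∀ y, Y' y = -Y y) {n : ℝ → E} (hn : Continuous n)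
    (hnS : ∀ t, n t ∈ D.noise) (hnS' : ∀ t, n t ∈ D'.noise) (hn0 : n 0 = 0) {T : ℝ} (hT : 0 ≤ T) :
    range (fun x => drivenFlow Y x n T) = univ :=
  (D.flow_bijective D' hY' hn hnS hnS' hn0 hT).surjective.range_eq

end ConfinedDrift

end Literature.MathematicalPhysics.KineticTheory
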